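import Summits.HodgeConjecture.HodgeConjecture.Theorems.LinearSystemTorelliLocalTubeSpanTypedAssembly
import Summits.HodgeConjecture.HodgeConjecture.Theorems.LinearSystemTorelliLocalTubeSpanVanishingTransfer
import Summits.HodgeConjecture.HodgeConjecture.Theorems.LinearSystemTorelliLocalTubeSpanConj
import Summits.HodgeConjecture.HodgeConjecture.Theorems.LinearSystemTorelliLocalTubeSpanLocalSubgroupConj

/-!
# Route LinearSystemTorelli — crux `LocalTubeSpan` (stmt-HodgeConjecture-2490): typed assembly on the VANISHING local system, and one view point per ball

Helper file (`--supports stmt-HodgeConjecture-2490`, line `Sketch` of the crux chain, cycle 5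
"assembly on the tree's hyperplane-section package", compositions by the lead; companion of
`…TypedAssembly`).

The crux's typed candidates (`LocalTubeSpanCFree(Balls)`, crux workfile
`Lines/SketchTypedCandidate.lean`) are stated on the VANISHING sub-local system
`D.vanishingLocalSystem μ hX hb` of a `HyperplaneSectionLocalSystem π n j`
(`Literature/AlgebraicGeometry/HodgeTheory/HyperplaneSectionLocalSystem`), while the constructed
`ℚ`-form `DirectImageLocalSystem.ratMonodromy` lives on the full `Rⁿ π_* ℂ`.  Given the Lefschetz
splitting `Hⁿ(X_s(ℂ); ℂ) = Hⁿ(X_s)_van ⊕ i^*Hⁿ(X(ℂ); ℂ)` as the hypothesis `IsCompl` (C. Voisin,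
*Hodge Theory and Complex Algebraic Geometry II* (2003), Prop. 2.27; the complement is
monodromy-trivial), `localTubeSpan_vanishingTransfer` moves cyclic detection between the two
carriers, and the three typed statements of `…TypedAssembly` follow on the vanishing carrier:

* `localTubeSpan_ker_evalCoinvOn_vanishing_eq_H1resKer_of_rat` — the typed surrogate at a subgroup
  `S ≤ π₁(U, s)` from `ℚ`-cyclic detection of the rational monodromy at `S`;
* `localTubeSpan_localKernelOn_vanishing_eq_iInf_ker_of_rat` — `localKernelOn = ⨅ ker evalCoinvOn`
  at a path-connected piece from ONE view point;
* `localTubeSpan_mem_localKernel_vanishing_of_rat_balls` — the colimit (`localKernel`) form at `t₀`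
  from `ℚ`-cyclic detection at the local subgroups of all small open balls;
* `localTubeSpan_localKernelOn_vanishing_eq_iInf_ker_of_ncNodal` — the NC-nodal member on the
  vanishing carrier (unconditional modulo the Lefschetz splitting);
* `localTubeSpan_surrogate_of_rat_of_isPathConnected`, `localTubeSpan_mem_localKernel_of_rat_balls_one`
  (+ `…_vanishing_…`) — ONE VIEW POINT PER BALL: when `ι⁻¹ N'` is path connected the local
  subgroups at `N'` are conjugate (`localTubeSpan_localSubgroup_conj_of_joinedIn`) and the surrogate is
  conjugation invariant (`localTubeSpan_surrogate_conj_iff`), so in the balls hypothesis `ℚ`-cyclic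
  detection at ONE view point of each small ball suffices (punctured balls `B ∖ Δ` are path
  connected) — the final typed shape: `∀` small open `N'`, path-connectedness of `ι⁻¹ N'` and
  `ℚ`-detection at one local subgroup.

No named facts; no `sorry`.
-/

-- `Summit.HodgeConjecture.HodgeConjecture.Theorems` is the mandated namespace (single-conjunct summit:
-- Sub = Summit), which `linter.dupNamespace` flags on every declaration; the lakefile turns the
-- linter off tree-wide (weak option), restated here so stand-alone elaboration is warning-free too.
set_option linter.dupNamespace false

noncomputable section

open CategoryTheory groupCohomology
open _root_.Topology Filter
open Literature.AlgebraicGeometry Literature.AlgebraicGeometry.HodgeTheory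
open Literature.AlgebraicTopology.SingularHomology
open scoped Pointwise

namespace Summit.HodgeConjecture.HodgeConjecture.Theorems

universe v

variable {𝒳 Sb : Motives.SchemeOver ℂ} {π : 𝒳 ⟶ Sb} {n : ℕ} {T : Type v} [TopologicalSpace T]

variable {X : Motives.SchemeOver ℂ} {j : 𝒳 ⟶ X}

/-- **The typed surrogate at a subgroup for the VANISHING local system from `ℚ`-cyclic detection.**
Given the Lefschetz splitting `Hⁿ(X_s(ℂ); ℂ) = Hⁿ(X_s)_van ⊕ i^*Hⁿ(X(ℂ); ℂ)` (hypothesis `IsCompl`),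
if Schnell's third map of the rational monodromy of `Rⁿ π_* ℂ` restricted to `S ≤ π₁(U, s)` is
injective, then for the monodromy representation of the vanishing sub-local system the classes
undetected by every element of `S` are exactly those restricting to zero on `S`
(`localTubeSpan_vanishingTransfer` + `localTubeSpan_injective_evalCoinv_res_iff_rat`). -/
theorem localTubeSpan_ker_evalCoinvOn_vanishing_eq_H1resKer_of_rat
    (D : HyperplaneSectionLocalSystem π n j) (μ : OrientationFamily) {m b : ℕ}
    (hX : Motives.IsSmoothProjective m X) (hb : n + 2 * m = b + 2 * n) (s : smoothFiberLocus π n)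
    (hcompl : IsCompl (vanishing π n j μ hX hb s)
      (LinearMap.range (complexBetti.map (Motives.fiberι π s.1 ≫ j) n).hom))
    (S : Subgroup (FundamentalGroup (smoothFiberLocus π n) s))
    (hinj : Function.Injective
      (evalCoinv (Rep.res S.subtype (Rep.of (D.toDirectImageLocalSystem.ratMonodromy n s))))) :
    LinearMap.ker (evalCoinvOn (monodromyRepObj (D.vanishingLocalSystem μ hX hb) s) S) =
      H1resKer (monodromyRepObj (D.vanishingLocalSystem μ hX hb) s) S :=
  localTubeSpan_ker_evalCoinvOn_eq_H1resKer_of_injective _ S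
    ((localTubeSpan_vanishingTransfer D μ hX hb s hcompl S).2
      ((localTubeSpan_injective_evalCoinv_res_iff_rat D.toDirectImageLocalSystem n s S).1 hinj))

/-- **The typed statement at a path-connected piece for the VANISHING local system**, from
`ℚ`-cyclic detection at ONE local subgroup and the Lefschetz splitting. -/
theorem localTubeSpan_localKernelOn_vanishing_eq_iInf_ker_of_rat (ι : C(smoothFiberLocus π n, T))
    (D : HyperplaneSectionLocalSystem π n j) (μ : OrientationFamily) {m b : ℕ}
    (hX : Motives.IsSmoothProjective m X) (hb : n + 2 * m = b + 2 * n) (s : smoothFiberLocus π n)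
    (hcompl : IsCompl (vanishing π n j μ hX hb s)
      (LinearMap.range (complexBetti.map (Motives.fiberι π s.1 ≫ j) n).hom))
    (N : Set T) (hN : IsPathConnected (ι ⁻¹' N)) {s' : smoothFiberLocus π n} (hs' : ι s' ∈ N)
    (γ : Path s' s)
    (hinj : Function.Injective (evalCoinv (Rep.res (localSubgroup ι s N hs' γ).subtype
      (Rep.of (D.toDirectImageLocalSystem.ratMonodromy n s))))) :
    localKernelOn ι (D.vanishingLocalSystem μ hX hb) s N =
      ⨅ (s₂ : smoothFiberLocus π n) (hs₂ : ι s₂ ∈ N) (γ₂ : Path s₂ s),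
        LinearMap.ker (evalCoinvOn (monodromyRepObj (D.vanishingLocalSystem μ hX hb) s)
          (localSubgroup ι s N hs₂ γ₂)) :=
  localTubeSpan_localKernelOn_eq_iInf_ker_of_one ι (D.vanishingLocalSystem μ hX hb) s N hN hs' γ
    (localTubeSpan_ker_evalCoinvOn_vanishing_eq_H1resKer_of_rat D μ hX hb s hcompl _ hinj)

/-- **The colimit form at `t₀` for the VANISHING local system** (the shape `LocalTubeSpanCFree` of
the crux's typed candidate, on its own carrier): from `ℚ`-cyclic detection of the rational
monodromy of `Rⁿ π_* ℂ` at the local subgroups of all small open balls around `t₀` and the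
Lefschetz splitting, a class of `H¹(π₁(U, s), (V_van)_s)` undetected on the local subgroups of some
neighbourhood of `t₀` lies in `localKernel ι (D.vanishingLocalSystem μ hX hb) s t₀`. -/
theorem localTubeSpan_mem_localKernel_vanishing_of_rat_balls (ι : C(smoothFiberLocus π n, T))
    (D : HyperplaneSectionLocalSystem π n j) (μ : OrientationFamily) {m b : ℕ}
    (hX : Motives.IsSmoothProjective m X) (hb : n + 2 * m = b + 2 * n) (s : smoothFiberLocus π n)
    (hcompl : IsCompl (vanishing π n j μ hX hb s)
      (LinearMap.range (complexBetti.map (Motives.fiberι π s.1 ≫ j) n).hom))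
    (t₀ : T)
    (hballs : ∃ N₀ ∈ 𝓝 t₀, ∀ N' ∈ 𝓝 t₀, N' ⊆ N₀ → IsOpen N' →
      ∀ (s' : smoothFiberLocus π n) (hs' : ι s' ∈ N') (γ : Path s' s),
        Function.Injective (evalCoinv (Rep.res (localSubgroup ι s N' hs' γ).subtype
          (Rep.of (D.toDirectImageLocalSystem.ratMonodromy n s)))))
    (ξ : groupCohomology.H1 (monodromyRepObj (D.vanishingLocalSystem μ hX hb) s))
    (hξ : ∃ N ∈ 𝓝 t₀, ∀ (s' : smoothFiberLocus π n) (hs' : ι s' ∈ N) (γ : Path s' s),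
      evalCoinvOn (monodromyRepObj (D.vanishingLocalSystem μ hX hb) s)
        (localSubgroup ι s N hs' γ) ξ = 0) :
    ξ ∈ localKernel ι (D.vanishingLocalSystem μ hX hb) s t₀ := by
  obtain ⟨N₀, hN₀, h⟩ := hballs
  exact localTubeSpan_mem_localKernel_of_balls ι (D.vanishingLocalSystem μ hX hb) s t₀
    ⟨N₀, hN₀, fun N' hN' hsub hopen s' hs' γ =>
      localTubeSpan_ker_evalCoinvOn_vanishing_eq_H1resKer_of_rat D μ hX hb s hcompl _
        (h N' hN' hsub hopen s' hs' γ)⟩ ξ hξ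

/-- **The normal-crossing nodal member on the VANISHING carrier, unconditionally** (modulo the
Lefschetz splitting): one local subgroup at the path-connected piece `N` generated by finitely many
elements acting on `Hⁿ(X_s(ℂ); ℚ)` as Picard–Lefschetz transvections along mutually orthogonal
non-zero cycles of a nondegenerate form ⇒ `localKernelOn ι (D.vanishingLocalSystem μ hX hb) s N` is
the space of classes undetected on all local subgroups at `N` (`…NCNodal` on the rational monodromy
restricted to that subgroup, then `localTubeSpan_localKernelOn_vanishing_eq_iInf_ker_of_rat`). -/
theorem localTubeSpan_localKernelOn_vanishing_eq_iInf_ker_of_ncNodal (ι : C(smoothFiberLocus π n, T))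
    (D : HyperplaneSectionLocalSystem π n j) (μ : OrientationFamily) {m b : ℕ}
    (hX : Motives.IsSmoothProjective m X) (hb : n + 2 * m = b + 2 * n) (s : smoothFiberLocus π n)
    (hcompl : IsCompl (vanishing π n j μ hX hb s)
      (LinearMap.range (complexBetti.map (Motives.fiberι π s.1 ≫ j) n).hom))
    (N : Set T) (hN : IsPathConnected (ι ⁻¹' N)) {s' : smoothFiberLocus π n} (hs' : ι s' ∈ N)
    (γ : Path s' s)
    (B : LinearMap.BilinForm ℚ (Motives.bettiCohomology (Motives.fiberOver π s.1) n))
    (hB : B.Nondegenerate) {r : ℕ} (t : Fin r → localSubgroup ι s N hs' γ)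
    (ht : Subgroup.closure (Set.range t) = ⊤)
    (δ : Fin r → Motives.bettiCohomology (Motives.fiberOver π s.1) n) (hδ : ∀ i, δ i ≠ 0)
    (hPL : ∀ (i : Fin r) (x : Motives.bettiCohomology (Motives.fiberOver π s.1) n),
      D.toDirectImageLocalSystem.ratMonodromy n s (t i : FundamentalGroup (smoothFiberLocus π n) s) x =
        x - B x (δ i) • δ i)
    (horth : ∀ i j, B (δ i) (δ j) = 0) :
    localKernelOn ι (D.vanishingLocalSystem μ hX hb) s N =
      ⨅ (s₂ : smoothFiberLocus π n) (hs₂ : ι s₂ ∈ N) (γ₂ : Path s₂ s),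
        LinearMap.ker (evalCoinvOn (monodromyRepObj (D.vanishingLocalSystem μ hX hb) s)
          (localSubgroup ι s N hs₂ γ₂)) := by
  refine localTubeSpan_localKernelOn_vanishing_eq_iInf_ker_of_rat ι D μ hX hb s hcompl N hN hs' γ ?_
  haveI : FiniteDimensional ℚ (Rep.res (localSubgroup ι s N hs' γ).subtype
      (Rep.of (D.toDirectImageLocalSystem.ratMonodromy n s))).V :=
    (localTubeSpan_ratTensorEquiv D.toDirectImageLocalSystem n s _
      (D.toDirectImageLocalSystem.ofRatClass_ratMonodromy n s)).1
  exact localTubeSpan_injective_evalCoinv_of_orthogonal_transvections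
    (Rep.res (localSubgroup ι s N hs' γ).subtype
      (Rep.of (D.toDirectImageLocalSystem.ratMonodromy n s))) B hB t ht δ hδ (fun i x => hPL i x) horth

/-! ### One view point per ball -/

/-- **The surrogate at EVERY view point of a path-connected piece from `ℚ`-cyclic detection at ONE.**
If `ι⁻¹ N` is path connected and Schnell's third map of the rational monodromy restricted to the
local subgroup at one view point `(s₁, γ₁)` is injective, then for every view point `(s₂, γ₂)` at
`N` the classes undetected on `localSubgroup ι s N hs₂ γ₂` are exactly those restricting to zero on
it (the local subgroups are conjugate, the surrogate is conjugation invariant). -/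
theorem localTubeSpan_surrogate_of_rat_of_isPathConnected (ι : C(smoothFiberLocus π n, T)) (D : DirectImageLocalSystem π n) (k : ℕ)
    (s : smoothFiberLocus π n) (N : Set T) (hN : IsPathConnected (ι ⁻¹' N))
    {s₁ : smoothFiberLocus π n} (hs₁ : ι s₁ ∈ N) (γ₁ : Path s₁ s)
    (hinj : Function.Injective
      (evalCoinv (Rep.res (localSubgroup ι s N hs₁ γ₁).subtype (Rep.of (D.ratMonodromy k s)))))
    {s₂ : smoothFiberLocus π n} (hs₂ : ι s₂ ∈ N) (γ₂ : Path s₂ s) :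
    LinearMap.ker (evalCoinvOn (monodromyRepObj (D.V k) s) (localSubgroup ι s N hs₂ γ₂)) =
      H1resKer (monodromyRepObj (D.V k) s) (localSubgroup ι s N hs₂ γ₂) := by
  obtain ⟨h, hh⟩ := localTubeSpan_localSubgroup_conj_of_joinedIn ι s N hs₂ hs₁
    (hN.joinedIn s₂ hs₂ s₁ hs₁) γ₂ γ₁
  rw [hh, localTubeSpan_surrogate_conj_iff]
  exact localTubeSpan_ker_evalCoinvOn_eq_H1resKer_of_rat D k s _ hinj

/-- **The colimit form at `t₀` with ONE VIEW POINT PER BALL** (full carrier): if every sufficiently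
small open neighbourhood `N'` of `t₀` has path-connected `ι⁻¹ N'` (punctured balls `B ∖ Δ`) and ONE
view point at which Schnell's third map of the rational monodromy restricted to the local subgroup
is injective, then a class undetected on the local subgroups of some neighbourhood of `t₀` lies in
`localKernel ι (D.V k) s t₀`. -/
theorem localTubeSpan_mem_localKernel_of_rat_balls_one (ι : C(smoothFiberLocus π n, T)) (D : DirectImageLocalSystem π n) (k : ℕ)
    (s : smoothFiberLocus π n) (t₀ : T)
    (hballs : ∃ N₀ ∈ 𝓝 t₀, ∀ N' ∈ 𝓝 t₀, N' ⊆ N₀ → IsOpen N' →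
      IsPathConnected (ι ⁻¹' N') ∧
        ∃ (s' : smoothFiberLocus π n) (hs' : ι s' ∈ N') (γ : Path s' s),
          Function.Injective (evalCoinv
            (Rep.res (localSubgroup ι s N' hs' γ).subtype (Rep.of (D.ratMonodromy k s)))))
    (ξ : groupCohomology.H1 (monodromyRepObj (D.V k) s))
    (hξ : ∃ N ∈ 𝓝 t₀, ∀ (s' : smoothFiberLocus π n) (hs' : ι s' ∈ N) (γ : Path s' s),
      evalCoinvOn (monodromyRepObj (D.V k) s) (localSubgroup ι s N hs' γ) ξ = 0) :
    ξ ∈ localKernel ι (D.V k) s t₀ := by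
  obtain ⟨N₀, hN₀, h⟩ := hballs
  refine localTubeSpan_mem_localKernel_of_balls ι (D.V k) s t₀
    ⟨N₀, hN₀, fun N' hN' hsub hopen s₂ hs₂ γ₂ => ?_⟩ ξ hξ
  obtain ⟨hpc, s₁, hs₁, γ₁, hinj⟩ := h N' hN' hsub hopen
  exact localTubeSpan_surrogate_of_rat_of_isPathConnected ι D k s N' hpc hs₁ γ₁ hinj hs₂ γ₂

/-- **The colimit form at `t₀` with ONE VIEW POINT PER BALL, on the VANISHING local system** — the
final typed shape of the crux on the carrier of its typed candidates: Lefschetz splitting +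
path-connected punctured balls + `ℚ`-cyclic detection at one local subgroup per small ball ⇒
`LocalTubeSpanCFree` at `t₀`. -/
theorem localTubeSpan_mem_localKernel_vanishing_of_rat_balls_one (ι : C(smoothFiberLocus π n, T)) (D : HyperplaneSectionLocalSystem π n j)
    (μ : OrientationFamily) {m b : ℕ} (hX : Motives.IsSmoothProjective m X)
    (hb : n + 2 * m = b + 2 * n) (s : smoothFiberLocus π n)
    (hcompl : IsCompl (vanishing π n j μ hX hb s)
      (LinearMap.range (complexBetti.map (Motives.fiberι π s.1 ≫ j) n).hom))
    (t₀ : T)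
    (hballs : ∃ N₀ ∈ 𝓝 t₀, ∀ N' ∈ 𝓝 t₀, N' ⊆ N₀ → IsOpen N' →
      IsPathConnected (ι ⁻¹' N') ∧
        ∃ (s' : smoothFiberLocus π n) (hs' : ι s' ∈ N') (γ : Path s' s),
          Function.Injective (evalCoinv (Rep.res (localSubgroup ι s N' hs' γ).subtype
            (Rep.of (D.toDirectImageLocalSystem.ratMonodromy n s)))))
    (ξ : groupCohomology.H1 (monodromyRepObj (D.vanishingLocalSystem μ hX hb) s))
    (hξ : ∃ N ∈ 𝓝 t₀, ∀ (s' : smoothFiberLocus π n) (hs' : ι s' ∈ N) (γ : Path s' s),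
      evalCoinvOn (monodromyRepObj (D.vanishingLocalSystem μ hX hb) s)
        (localSubgroup ι s N hs' γ) ξ = 0) :
    ξ ∈ localKernel ι (D.vanishingLocalSystem μ hX hb) s t₀ := by
  obtain ⟨N₀, hN₀, h⟩ := hballs
  refine localTubeSpan_mem_localKernel_of_balls ι (D.vanishingLocalSystem μ hX hb) s t₀
    ⟨N₀, hN₀, fun N' hN' hsub hopen s₂ hs₂ γ₂ => ?_⟩ ξ hξ
  obtain ⟨hpc, s₁, hs₁, γ₁, hinj⟩ := h N' hN' hsub hopen
  obtain ⟨g, hg⟩ := localTubeSpan_localSubgroup_conj_of_joinedIn ι s N' hs₂ hs₁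
    (hpc.joinedIn s₂ hs₂ s₁ hs₁) γ₂ γ₁
  rw [hg, localTubeSpan_surrogate_conj_iff]
  exact localTubeSpan_ker_evalCoinvOn_vanishing_eq_H1resKer_of_rat D μ hX hb s hcompl _ hinj

end Summit.HodgeConjecture.HodgeConjecture.Theorems

end
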